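import Literature.Topology.FourManifolds.RangeHalfSliceAtlas
import Literature.Topology.FourManifolds.RegularDomainMaps
import Literature.Topology.FourManifolds.CylinderCobordism
import Literature.Geometry.Manifold.SmoothEmbeddingInverse
import HarnessLib

/-!
# A compact piece is diffeomorphic to its image, as a regular domain

Topic `Literature/Topology/FourManifolds` (namespace `Literature.Topology.FourManifolds`).
Continuation of `RangeHalfSliceAtlas.lean`: for an equidimensional `C^∞` embedding `jA : A ↪ X`
of a manifold with boundary into a boundaryless manifold (dimension `k + 2 ≥ 2`), the image
`S = range jA` with the manifold-with-boundary structure `Φ.chartedSpace` of ANY half-slice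
atlas `Φ` (e.g. the one of `nonempty_halfSliceAtlas_range`) is diffeomorphic to `A` through
`jA` itself (Lee, *Introduction to Smooth Manifolds* (2013), Prop. 5.2 / Thm. 5.48: an embedded
submanifold has a unique smooth structure making the inclusion an embedding, and the embedding a
diffeomorphism onto it):

* `exists_diffeomorph_range` — **`jA : A ≅ range jA`** as a `C^∞` diffeomorphism for
  `Φ.chartedSpace`: `jA` is smooth into the regular domain (`HalfSliceAtlas.contMDiff_codRestrict`,
  `RegularDomainMaps.lean`) and its inverse is `invFun jA ∘ Subtype.val`, smooth because the
  inverse of a smooth embedding is smooth on its range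
  (`Literature.Geometry.Manifold.contMDiffOn_invFun_range`, `SmoothEmbeddingInverse.lean`).

Use (layer L1 of `Literature.Geometry.Riemannian.BaerHankePscGluing`): smooth objects on the
piece `M` are moved to the regular domain `jM(M) ⊆ P`, where the tree's Seeley extension
`HalfSliceAtlas.exists_contMDiff_forall_eq` extends them to `P`.

Everything is proved; no definitions and no named facts are introduced.

## References

* J. M. Lee, *Introduction to Smooth Manifolds*, 2nd ed., GTM 218 (2013), Prop. 5.2, Thm. 5.48,
  Cor. 5.30. [LeeSmoothManifolds2013]
-/

open scoped Manifold ContDiff Topology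
open Set Function

noncomputable section

namespace Literature.Topology.FourManifolds

universe u

/-! ### The piece is diffeomorphic to its image -/

section Range

variable {k : ℕ} {A : Type u} [TopologicalSpace A] [ChartedSpace (EuclideanHalfSpace (k + 2)) A]
  {X : Type u} [TopologicalSpace X] [ChartedSpace (EuclideanSpace ℝ (Fin (k + 2))) X]
  [IsManifold (𝓡 (k + 2)) ∞ X] {jA : A → X}

/-- **`jA` is smooth into its image** `range jA` (regular-domain structure of any half-slice
atlas `Φ`). Lee (2013), Cor. 5.30. [cite: LeeSmoothManifolds2013, Cor. 5.30] -/
theorem contMDiff_rangeFactorization (Φ : HalfSliceAtlas (𝓡 (k + 2)) (range jA))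
    (hjA : ContMDiff (𝓡∂ (k + 2)) (𝓡 (k + 2)) ∞ jA) :
    letI := Φ.chartedSpace
    ContMDiff (𝓡∂ (k + 2)) (𝓡∂ (k + 2)) ∞ (rangeFactorization jA) :=
  Φ.contMDiff_codRestrict (fun a ↦ mem_range_self a) hjA

/-- **The inverse of a smooth embedding, from its image**: `invFun jA ∘ Subtype.val` is `C^∞` on
the regular domain `range jA` (inclusion smooth: the tree's
`HalfSliceAtlas.contMDiff_subtype_val_of_boundaryless`, `CylinderCobordism.lean`; inverse smooth
on the range: `Literature.Geometry.Manifold.contMDiffOn_invFun_range`).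
Lee (2013), Prop. 5.2 / Thm. 5.48. [cite: LeeSmoothManifolds2013, Thm. 5.48] -/
theorem contMDiff_invFun_comp_val [Nonempty A] (Φ : HalfSliceAtlas (𝓡 (k + 2)) (range jA))
    (hjA : Manifold.IsSmoothEmbedding (𝓡∂ (k + 2)) (𝓡 (k + 2)) ∞ jA) :
    letI := Φ.chartedSpace
    ContMDiff (𝓡∂ (k + 2)) (𝓡∂ (k + 2)) ∞ (invFun jA ∘ (Subtype.val : range jA → X)) := by
  letI := Φ.chartedSpace
  exact (Literature.Geometry.Manifold.contMDiffOn_invFun_range hjA).comp_contMDiff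
    Φ.contMDiff_subtype_val_of_boundaryless fun s ↦ s.2

/-- **A piece is diffeomorphic to its image.** For an equidimensional `C^∞` embedding
`jA : A ↪ X` of a manifold with boundary into a boundaryless manifold (dimension `k + 2 ≥ 2`)
and any half-slice atlas `Φ` of `range jA` (one exists: `nonempty_halfSliceAtlas_range`), `jA`
induces a `C^∞` diffeomorphism `A ≅ range jA` for the regular-domain structure `Φ.chartedSpace`.
Lee (2013), Prop. 5.2 and Thm. 5.48. [cite: LeeSmoothManifolds2013, Prop. 5.2 and Thm. 5.48] -/
theorem exists_diffeomorph_range [Nonempty A] (Φ : HalfSliceAtlas (𝓡 (k + 2)) (range jA))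
    (hjA : Manifold.IsSmoothEmbedding (𝓡∂ (k + 2)) (𝓡 (k + 2)) ∞ jA) :
    letI := Φ.chartedSpace
    ∃ e : A ≃ₘ^∞⟮𝓡∂ (k + 2), 𝓡∂ (k + 2)⟯ (range jA), ∀ a, (e a).1 = jA a := by
  letI := Φ.chartedSpace
  have hinj : Injective jA := hjA.isEmbedding.injective
  have hsymm : ∀ s : range jA, (Equiv.ofInjective jA hinj).symm s = invFun jA s.1 := fun s ↦ by
    apply hinj
    rw [Equiv.apply_ofInjective_symm hinj s, invFun_eq s.2]
  refine ⟨{ toEquiv := Equiv.ofInjective jA hinj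
            contMDiff_toFun := contMDiff_rangeFactorization Φ hjA.contMDiff
            contMDiff_invFun := ?_ }, fun a ↦ rfl⟩
  have h := contMDiff_invFun_comp_val Φ hjA
  refine h.congr fun s ↦ ?_
  exact hsymm s

end Range

end Literature.Topology.FourManifolds

end
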